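import Summits.QuantumFields.BalabanUV.Beta.GAN24.MonotoneBlocks
import Summits.QuantumFields.BalabanUV.Beta.GAN24.MonotoneLoewner

/-!
# Beta / GAN24 / MonotoneComposite — ONE-STEP DOMINATION at every level ⟹ the composite effective forms INCREASE ⟹ Loewner chains of the
# one-step blocks ⟹ (MONO-K)₂ with one trace datum (the located term of road P4 reduced to ONE Loewner inequality per step)
# (gan24-p4, BINDER-OWNERS row G-an2-4 ∕ (CONV-C), ALTERNATIVE DISCHARGE «rate OR monotonicity»; NOT IN PRINT — our proof attempt)

HONEST FRAMING (page 1 of everything the β sub-cell writes): discharging `BetaPertH` makes Bałaban's UV stability UNCONDITIONAL — a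
real constructive-QFT result; it is NOT the continuum limit and NOT the Clay problem.  HONEST DEPENDENCY (cell reorg 2026-08-19, verbatim):
«continuum YM on T⁴ ⇐ BetaPertH ∧ nine spine estimates (0/9 proved); BetaPertH ⇐ (D1) ∧ (D4) ∧ CAP+tail; G-an2-4 gates asym, D1 and NE2/3/4.»
HONEST LABEL: «not in print; our proof attempt; alternative discharge of the G-an2-4 row (rate OR monotonicity)»; 0 wall binders instantiated.

ABSOLUTE RULE (cell charter, verbatim): "No internally-minted statement may enter as a cited fact. Every hypothesis is either
kernel-proved in this package or a verbatim quotation of a PUBLISHED theorem with page reference. The manuscript(s) under audit are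
NOT citable for their own disputed steps — they are the thing under adjudication; programme-internal (2001/route/tribunal) claims
are never citable."  Nothing is cited; [folklore] throughout (p3's composition law `effForm_comp` and gan24-p4's `MonotoneBlocks` BY NAME).

## WHAT IS PROVED (`HOME/b2b-balaban-gan24-p4/MONOTONE.md` §6, (OSD)).  A TOWER: leg types `ι j` at depth `j` below a fixed coarse level `c`,
positive definite fine forms `H j` on `ι j`, one-step averagings `Qf j : ι (j+1) → ι j` and composite averagings `Qc j : ι j → c` with
`Qc (j+1) = Qc j * Qf j` (rows independent).  The composite EFFECTIVE FORM `E j := Δ_eff(H j, Qc j)` on `c` is, by p3's composition law,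
`E (j+1) = Δ_eff(Δ_eff(H (j+1), Qf j), Qc j)`; hence the SINGLE comparison per level

  (OSD_j)  `Δ_eff(H (j+1), Qf j) ≥ H j`   («one RG step applied to the finer bare form dominates the bare form»)

gives `E (j+1) ≥ E j` (`effForm_chain_step`, by `MonotoneBlocks.effForm_monotone`), and then for EVERY next-step constraint `Q : c → m` with independent
rows the one-step blocks over `E j` form Loewner chains — `Γ(E j, Q)` DECREASING (`flucCov_chain_step`), `Δ_eff(E j, Q)` INCREASING
(`effForm₂_chain_step`) — so that over `ℂ` `MonotoneLoewner.norm_sub_apply_le_of_steps` bounds every entry deviation beyond `k₀` by ONE trace datum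
(`flucCov_entry_dev_le_of_osd`).  For Bałaban's gauge-invariant (1.66) form the n = Lc instance of (OSD) is asym1's `MonotoneScales.d1Sq_le_formDk`
(bare Maxwell form ≤ one-step effective form); for the β lane's weak-block-gauge one-step system (`Beta.BlochFibreMatrix`, non-symmetric in (A, μ, φ))
(OSD) is not yet typable — its inverse blocks must first be presented as p3-blocks over an effective form (p3 R7′, an2 NODE (ii-0), row D1): the located term.
-/

namespace Summit.QuantumFields.BalabanUV.Beta.GAN24.MonotoneComposite

open Matrix
open Summit.QuantumFields.BalabanUV.Beta.PropagatorWoodburyFibre (pivot effForm flucCov effForm_comp effForm_posDef isUnit_pivot_of_posDef)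
open Summit.QuantumFields.BalabanUV.Beta.GAN24.MonotoneBlocks (effForm_monotone flucCov_antitone)

section Generic

variable {𝕜 : Type*} [Field 𝕜] [PartialOrder 𝕜] [StarRing 𝕜] [StarOrderedRing 𝕜]
variable {c : Type*} [Fintype c] [DecidableEq c]
variable {ι : ℕ → Type*} [∀ j, Fintype (ι j)] [∀ j, DecidableEq (ι j)]
variable {H : ∀ j, Matrix (ι j) (ι j) 𝕜} {Qf : ∀ j, Matrix (ι j) (ι (j + 1)) 𝕜} {Qc : ∀ j, Matrix c (ι j) 𝕜} {k₀ : ℕ}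

omit [PartialOrder 𝕜] [StarRing 𝕜] [StarOrderedRing 𝕜] in
/-- composite averagings have independent rows when their factors do. [folklore] -/
theorem vecMul_injective_mul {l m n : Type*} [Fintype l] [Fintype m] {A : Matrix l m 𝕜} {B : Matrix m n 𝕜}
    (hA : Function.Injective A.vecMul) (hB : Function.Injective B.vecMul) : Function.Injective (A * B).vecMul := by
  intro v w h
  apply hA
  apply hB
  simpa [Matrix.vecMul_vecMul] using h

/-- **(OSD) ⟹ THE COMPOSITE EFFECTIVE FORMS INCREASE**: `Δ_eff(H (j+1), Qc (j+1)) − Δ_eff(H j, Qc j)` is PSD for `j ≥ k₀`. [folklore] -/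
theorem effForm_chain_step (hH : ∀ j, (H j).PosDef) (hQf : ∀ j, Function.Injective (Qf j).vecMul)
    (hQc : ∀ j, Function.Injective (Qc j).vecMul) (hcomp : ∀ j, Qc (j + 1) = Qc j * Qf j)
    (hOSD : ∀ j, k₀ ≤ j → (effForm (H (j + 1)) (Qf j) - H j).PosSemidef) :
    ∀ j, k₀ ≤ j → (effForm (H (j + 1)) (Qc (j + 1)) - effForm (H j) (Qc j)).PosSemidef := by
  intro j hj
  rw [hcomp j, effForm_comp (isUnit_pivot_of_posDef (hH (j + 1)) (hQf j)) (Qc j)]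
  exact effForm_monotone (hH j) (effForm_posDef (hH (j + 1)) (hQf j)) (hOSD j hj) (hQc j)

variable {m : Type*} [Fintype m] [DecidableEq m] {Q : Matrix m c 𝕜}

/-- **… ⟹ THE ONE-STEP FLUCTUATION COVARIANCE OVER THE COMPOSITE FORM DECREASES**: for every next-step constraint `Q` with independent rows,
`Γ(E j, Q) − Γ(E (j+1), Q)` is PSD (`E j := Δ_eff(H j, Qc j)`). [folklore] -/
theorem flucCov_chain_step (hH : ∀ j, (H j).PosDef) (hQf : ∀ j, Function.Injective (Qf j).vecMul)
    (hQc : ∀ j, Function.Injective (Qc j).vecMul) (hcomp : ∀ j, Qc (j + 1) = Qc j * Qf j)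
    (hOSD : ∀ j, k₀ ≤ j → (effForm (H (j + 1)) (Qf j) - H j).PosSemidef) (hQ : Function.Injective Q.vecMul) :
    ∀ j, k₀ ≤ j → (flucCov (effForm (H j) (Qc j)) Q - flucCov (effForm (H (j + 1)) (Qc (j + 1))) Q).PosSemidef := fun j hj =>
  flucCov_antitone (effForm_posDef (hH j) (hQc j)) (effForm_posDef (hH (j + 1)) (hQc (j + 1)))
    (effForm_chain_step hH hQf hQc hcomp hOSD j hj) hQ

/-- **… ⟹ THE NEXT EFFECTIVE FORM INCREASES**: `Δ_eff(E (j+1), Q) − Δ_eff(E j, Q)` is PSD. [folklore] -/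
theorem effForm₂_chain_step (hH : ∀ j, (H j).PosDef) (hQf : ∀ j, Function.Injective (Qf j).vecMul)
    (hQc : ∀ j, Function.Injective (Qc j).vecMul) (hcomp : ∀ j, Qc (j + 1) = Qc j * Qf j)
    (hOSD : ∀ j, k₀ ≤ j → (effForm (H (j + 1)) (Qf j) - H j).PosSemidef) (hQ : Function.Injective Q.vecMul) :
    ∀ j, k₀ ≤ j → (effForm (effForm (H (j + 1)) (Qc (j + 1))) Q - effForm (effForm (H j) (Qc j)) Q).PosSemidef := fun j hj =>
  effForm_monotone (effForm_posDef (hH j) (hQc j)) (effForm_posDef (hH (j + 1)) (hQc (j + 1)))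
    (effForm_chain_step hH hQf hQc hcomp hOSD j hj) hQ

end Generic

/-! ## Over `ℂ`: (OSD) ⟹ (MONO-K)₂ for the `Γ`-block with ONE trace datum -/

section Complex

open scoped ComplexOrder
open Summit.QuantumFields.BalabanUV.Beta.GAN24.MonotoneLoewner (norm_sub_apply_le_of_steps monotoneTailDown_re_trace)
open Summit.QuantumFields.BalabanUV.Beta.CapRowsTail (MonotoneTailDown)

variable {c : Type*} [Fintype c] [DecidableEq c]
variable {ι : ℕ → Type*} [∀ j, Fintype (ι j)] [∀ j, DecidableEq (ι j)]
variable {H : ∀ j, Matrix (ι j) (ι j) ℂ} {Qf : ∀ j, Matrix (ι j) (ι (j + 1)) ℂ} {Qc : ∀ j, Matrix c (ι j) ℂ} {k₀ : ℕ}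
variable {m : Type*} [Fintype m] [DecidableEq m] {Q : Matrix m c ℂ}

/-- **(OSD) AT EVERY LEVEL `j ≥ k₀` + ONE TRACE DATUM ⟹ (MONO-K)₂ FOR THE `Γ`-BLOCK**: every entry of `Γ(E j, Q) − Γ(E j', Q)` (`j, j' ≥ k₀`) is
bounded by the trace of `Γ` lost after `k₀`; and the trace majorant is non-increasing (an5's socket). NO rate. [folklore] -/
theorem flucCov_entry_dev_le_of_osd (hH : ∀ j, (H j).PosDef) (hQf : ∀ j, Function.Injective (Qf j).vecMul)
    (hQc : ∀ j, Function.Injective (Qc j).vecMul) (hcomp : ∀ j, Qc (j + 1) = Qc j * Qf j)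
    (hOSD : ∀ j, k₀ ≤ j → (effForm (H (j + 1)) (Qf j) - H j).PosSemidef) (hQ : Function.Injective Q.vecMul) {η₀ : ℝ}
    (hdat : ∀ j, k₀ ≤ j →
      (flucCov (effForm (H k₀) (Qc k₀)) Q - flucCov (effForm (H j) (Qc j)) Q).trace.re ≤ η₀) :
    (∀ j j', k₀ ≤ j → k₀ ≤ j' → ∀ a b,
        ‖(flucCov (effForm (H j) (Qc j)) Q - flucCov (effForm (H j') (Qc j')) Q) a b‖ ≤ η₀) ∧
      MonotoneTailDown (fun j => (flucCov (effForm (H j) (Qc j)) Q).trace.re) k₀ :=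
  ⟨norm_sub_apply_le_of_steps (P := fun j => flucCov (effForm (H j) (Qc j)) Q) (flucCov_chain_step hH hQf hQc hcomp hOSD hQ) hdat,
    monotoneTailDown_re_trace (P := fun j => flucCov (effForm (H j) (Qc j)) Q) (flucCov_chain_step hH hQf hQc hcomp hOSD hQ)⟩

end Complex

end Summit.QuantumFields.BalabanUV.Beta.GAN24.MonotoneComposite
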